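import Summits.AtomisticToContinuum.Crystallization.Theorems.ExcessDecayLiouvillePhononStabilityCertSymm
import Summits.AtomisticToContinuum.Crystallization.Theorems.ExcessDecayLiouvillePhononStabilityCertFrame
import Summits.AtomisticToContinuum.Crystallization.Theorems.ExcessDecayLiouvillePhononStabilityLabels
import Literature.Geometry.Lorentzian.KerrHyperboloidalLeaves

/-!
# Near-certificate layer V7-b: the basal mirrors of hcp and the in-plane fundamental domain (lead c2)

Support file for crux `PhononStability` (stmt-AtomisticToContinuum-9333), line `contragredient-window-collapse`.

Two vertical mirrors of the hcp structure as `LatticeIsometry`s: `mirUV` (swaps the generators `u ↔ v`, fixes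
`c` and the inner reference point `ι`) and `mirX` (`x ↦ −x`: `u ↦ −u`, `v ↦ v − u`, `ι ↦ ι − u`).  On the three
in-plane nearest-neighbour stretches `(‖Au‖, ‖Av‖, ‖A(u−v)‖)` they act as the transpositions `(12)` and `(23)`,
so every datum is re-described into the FUNDAMENTAL DOMAIN `‖Au‖ ≤ ‖Av‖ ≤ ‖A(u − v)‖` (`inPlaneOrdered`) by
one of six words; with `phononStabilityOn_of_redescription` the near certificate only has to cover one sixth
of the strain window.
-/

noncomputable section

open scoped BigOperators Classical InnerProductSpace
open Filter Set Function
open Literature.MathematicalPhysics.StatisticalMechanics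
open Summit.AtomisticToContinuum.Crystallization.Theses.ExcessDecayLiouville
open Summit.AtomisticToContinuum.Crystallization.Theorems.PhononStabilityNegative
open Summit.AtomisticToContinuum.Crystallization.Theorems.PhononStabilityCWC.Cert

namespace Summit.AtomisticToContinuum.Crystallization.Theorems.PhononStabilityCWC

local notation "E3" => EuclideanSpace ℝ (Fin 3)

/-! ## Coordinates of the reference vectors -/

/-- coordinates of `u, v, c = genU, genV, genC`. [folklore] -/
theorem genUVC_apply :
    (genU 0 = 1 ∧ genU 1 = 0 ∧ genU 2 = 0) ∧ (genV 0 = 1 / 2 ∧ genV 1 = √3 / 2 ∧ genV 2 = 0) ∧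
      (genC 0 = 0 ∧ genC 1 = 0 ∧ genC 2 = 2 * √(2 / 3)) := by
  have h := gen_apply
  simp only [gen, Matrix.cons_val_zero, Matrix.cons_val_one] at h
  refine ⟨⟨?_, ?_, ?_⟩, ⟨?_, ?_, ?_⟩, ⟨?_, ?_, ?_⟩⟩ <;>
    simp [genU, genV, genC, triangularVec₁, triangularVec₂, layerNormal]

/-! ## Mirrors from coordinate formulas -/

/-- the linear map with coordinates `(a x₀ + b x₁, b' x₀ + a' x₁, x₂)` -/
def planarMap (a b b' a' : ℝ) : E3 →ₗ[ℝ] E3 where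
  toFun x := WithLp.toLp 2 ![a * x 0 + b * x 1, b' * x 0 + a' * x 1, x 2]
  map_add' x y := by
    ext i; fin_cases i <;> simp <;> ring
  map_smul' r x := by
    ext i; fin_cases i <;> simp <;> ring

/-- coordinates of `planarMap`. [folklore] -/
theorem planarMap_apply (a b b' a' : ℝ) (x : E3) :
    planarMap a b b' a' x 0 = a * x 0 + b * x 1 ∧ planarMap a b b' a' x 1 = b' * x 0 + a' * x 1 ∧
      planarMap a b b' a' x 2 = x 2 := by
  refine ⟨?_, ?_, ?_⟩ <;> simp [planarMap]

/-- `(√3)² = 3`. [folklore] -/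
theorem sqrt3_sq : (√3 : ℝ) ^ 2 = 3 := Real.sq_sqrt (by norm_num)

/-- the mirror swapping `u` and `v`: reflection of the basal plane across the line at angle `π/6`. -/
def mirUVmap : E3 →ₗ[ℝ] E3 := planarMap (1 / 2) (√3 / 2) (√3 / 2) (-(1 / 2))

/-- the mirror `x ↦ −x` of the basal plane. -/
def mirXmap : E3 →ₗ[ℝ] E3 := planarMap (-1) 0 0 1

/-- `mirUV` is an involution. [folklore] -/
theorem mirUVmap_invol : Function.Involutive mirUVmap := by
  intro x
  obtain ⟨h0, h1, h2⟩ := planarMap_apply (1 / 2) (√3 / 2) (√3 / 2) (-(1 / 2)) x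
  obtain ⟨g0, g1, g2⟩ := planarMap_apply (1 / 2) (√3 / 2) (√3 / 2) (-(1 / 2)) (mirUVmap x)
  have h3 := sqrt3_sq
  ext i
  fin_cases i
  · change mirUVmap (mirUVmap x) 0 = x 0
    unfold mirUVmap at *; rw [g0, h0, h1]; linear_combination (1 / 4 * x 0) * h3
  · change mirUVmap (mirUVmap x) 1 = x 1
    unfold mirUVmap at *; rw [g1, h0, h1]; linear_combination (1 / 4 * x 1) * h3
  · change mirUVmap (mirUVmap x) 2 = x 2
    unfold mirUVmap at *; rw [g2, h2]

/-- `mirX` is an involution. [folklore] -/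
theorem mirXmap_invol : Function.Involutive mirXmap := by
  intro x
  obtain ⟨h0, h1, h2⟩ := planarMap_apply (-1) 0 0 1 x
  obtain ⟨g0, g1, g2⟩ := planarMap_apply (-1) 0 0 1 (mirXmap x)
  ext i
  fin_cases i
  · change mirXmap (mirXmap x) 0 = x 0
    unfold mirXmap at *; rw [g0, h0, h1]; ring
  · change mirXmap (mirXmap x) 1 = x 1
    unfold mirXmap at *; rw [g1, h0, h1]; ring
  · change mirXmap (mirXmap x) 2 = x 2
    unfold mirXmap at *; rw [g2, h2]

/-- `mirUV` preserves the norm. [folklore] -/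
theorem mirUVmap_norm (x : E3) : ‖mirUVmap x‖ = ‖x‖ := by
  have h3 := sqrt3_sq
  obtain ⟨h0, h1, h2⟩ := planarMap_apply (1 / 2) (√3 / 2) (√3 / 2) (-(1 / 2)) x
  have hsq : ‖mirUVmap x‖ ^ 2 = ‖x‖ ^ 2 := by
    rw [Literature.Geometry.Lorentzian.E3.norm_sq, Literature.Geometry.Lorentzian.E3.norm_sq]
    unfold mirUVmap; rw [h0, h1, h2]
    linear_combination (1 / 4 * (x 0) ^ 2 + 1 / 4 * (x 1) ^ 2) * h3
  nlinarith [norm_nonneg (mirUVmap x), norm_nonneg x, hsq]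

/-- `mirX` preserves the norm. [folklore] -/
theorem mirXmap_norm (x : E3) : ‖mirXmap x‖ = ‖x‖ := by
  obtain ⟨h0, h1, h2⟩ := planarMap_apply (-1) 0 0 1 x
  have hsq : ‖mirXmap x‖ ^ 2 = ‖x‖ ^ 2 := by
    rw [Literature.Geometry.Lorentzian.E3.norm_sq, Literature.Geometry.Lorentzian.E3.norm_sq]
    unfold mirXmap; rw [h0, h1, h2]; ring
  nlinarith [norm_nonneg (mirXmap x), norm_nonneg x, hsq]

/-- the mirror `u ↔ v` as a linear isometry equivalence -/
def mirUVli : E3 ≃ₗᵢ[ℝ] E3 :=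
  { LinearEquiv.ofInvolutive mirUVmap mirUVmap_invol with norm_map' := mirUVmap_norm }

/-- the mirror `x ↦ −x` as a linear isometry equivalence -/
def mirXli : E3 ≃ₗᵢ[ℝ] E3 :=
  { LinearEquiv.ofInvolutive mirXmap mirXmap_invol with norm_map' := mirXmap_norm }

/-- `mirUVli` applied. [folklore] -/
@[simp] theorem mirUVli_apply (x : E3) : mirUVli x = mirUVmap x := rfl
/-- `mirUVli` coerced to a function. [folklore] -/
theorem mirUVli_coe : ⇑mirUVli = ⇑mirUVmap := rfl
/-- `mirXli` applied. [folklore] -/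
@[simp] theorem mirXli_apply (x : E3) : mirXli x = mirXmap x := rfl
/-- `mirUVli` is its own inverse. [folklore] -/
@[simp] theorem mirUVli_symm_apply (x : E3) : mirUVli.symm x = mirUVmap x := by
  apply mirUVli.injective
  rw [LinearIsometryEquiv.apply_symm_apply, mirUVli_apply]
  exact (mirUVmap_invol x).symm
/-- `mirXli` is its own inverse. [folklore] -/
@[simp] theorem mirXli_symm_apply (x : E3) : mirXli.symm x = mirXmap x := by
  apply mirXli.injective
  rw [LinearIsometryEquiv.apply_symm_apply, mirXli_apply]
  exact (mirXmap_invol x).symm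

/-! ## Action on the reference vectors -/

/-- `mirUV u = v`, `mirUV v = u`, `mirUV c = c`, `mirUV ι = ι`. [folklore] -/
theorem mirUV_gens : mirUVmap genU = genV ∧ mirUVmap genV = genU ∧ mirUVmap genC = genC ∧ mirUVmap innerRef = innerRef := by
  obtain ⟨⟨u0, u1, u2⟩, ⟨v0, v1, v2⟩, ⟨c0, c1, c2⟩⟩ := genUVC_apply
  obtain ⟨i0, i1, i2⟩ := LabelsStub.innerRef_apply
  have h3 := sqrt3_sq
  refine ⟨?_, ?_, ?_, ?_⟩
  · obtain ⟨h0, h1, h2⟩ := planarMap_apply (1 / 2) (√3 / 2) (√3 / 2) (-(1 / 2)) genU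
    ext i; fin_cases i
    · change mirUVmap genU 0 = genV 0; unfold mirUVmap; rw [h0, u0, u1, v0]; ring
    · change mirUVmap genU 1 = genV 1; unfold mirUVmap; rw [h1, u0, u1, v1]; ring
    · change mirUVmap genU 2 = genV 2; unfold mirUVmap; rw [h2, u2, v2]
  · obtain ⟨h0, h1, h2⟩ := planarMap_apply (1 / 2) (√3 / 2) (√3 / 2) (-(1 / 2)) genV
    ext i; fin_cases i
    · change mirUVmap genV 0 = genU 0; unfold mirUVmap; rw [h0, v0, v1, u0]; linear_combination (1 / 4) * h3
    · change mirUVmap genV 1 = genU 1; unfold mirUVmap; rw [h1, v0, v1, u1]; ring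
    · change mirUVmap genV 2 = genU 2; unfold mirUVmap; rw [h2, v2, u2]
  · obtain ⟨h0, h1, h2⟩ := planarMap_apply (1 / 2) (√3 / 2) (√3 / 2) (-(1 / 2)) genC
    ext i; fin_cases i
    · change mirUVmap genC 0 = genC 0; unfold mirUVmap; rw [h0, c0, c1]; ring
    · change mirUVmap genC 1 = genC 1; unfold mirUVmap; rw [h1, c0, c1]; ring
    · change mirUVmap genC 2 = genC 2; unfold mirUVmap; rw [h2]
  · obtain ⟨h0, h1, h2⟩ := planarMap_apply (1 / 2) (√3 / 2) (√3 / 2) (-(1 / 2)) innerRef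
    ext i; fin_cases i
    · change mirUVmap innerRef 0 = innerRef 0; unfold mirUVmap; rw [h0, i0, i1]; linear_combination (1 / 12) * h3
    · change mirUVmap innerRef 1 = innerRef 1; unfold mirUVmap; rw [h1, i0, i1]; ring
    · change mirUVmap innerRef 2 = innerRef 2; unfold mirUVmap; rw [h2]

/-- `mirX u = −u`, `mirX v = v − u`, `mirX c = c`, `mirX ι = ι − u`. [folklore] -/
theorem mirX_gens : mirXmap genU = -genU ∧ mirXmap genV = genV - genU ∧ mirXmap genC = genC ∧
    mirXmap innerRef = innerRef - genU := by
  obtain ⟨⟨u0, u1, u2⟩, ⟨v0, v1, v2⟩, ⟨c0, c1, c2⟩⟩ := genUVC_apply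
  obtain ⟨i0, i1, i2⟩ := LabelsStub.innerRef_apply
  refine ⟨?_, ?_, ?_, ?_⟩
  · obtain ⟨h0, h1, h2⟩ := planarMap_apply (-1) 0 0 1 genU
    ext i; fin_cases i
    · change mirXmap genU 0 = (-genU) 0; unfold mirXmap; rw [PiLp.neg_apply, h0, u0, u1]; ring
    · change mirXmap genU 1 = (-genU) 1; unfold mirXmap; rw [PiLp.neg_apply, h1, u0, u1]; ring
    · change mirXmap genU 2 = (-genU) 2; unfold mirXmap; rw [PiLp.neg_apply, h2, u2]; ring
  · obtain ⟨h0, h1, h2⟩ := planarMap_apply (-1) 0 0 1 genV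
    ext i; fin_cases i
    · change mirXmap genV 0 = (genV - genU) 0; unfold mirXmap; rw [PiLp.sub_apply, h0, v0, v1, u0]; ring
    · change mirXmap genV 1 = (genV - genU) 1; unfold mirXmap; rw [PiLp.sub_apply, h1, v0, v1, u1]; ring
    · change mirXmap genV 2 = (genV - genU) 2; unfold mirXmap; rw [PiLp.sub_apply, h2, v2, u2]; ring
  · obtain ⟨h0, h1, h2⟩ := planarMap_apply (-1) 0 0 1 genC
    ext i; fin_cases i
    · change mirXmap genC 0 = genC 0; unfold mirXmap; rw [h0, c0, c1]; ring
    · change mirXmap genC 1 = genC 1; unfold mirXmap; rw [h1, c0, c1]; ring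
    · change mirXmap genC 2 = genC 2; unfold mirXmap; rw [h2]
  · obtain ⟨h0, h1, h2⟩ := planarMap_apply (-1) 0 0 1 innerRef
    ext i; fin_cases i
    · change mirXmap innerRef 0 = (innerRef - genU) 0; unfold mirXmap; rw [PiLp.sub_apply, h0, i0, i1, u0]; ring
    · change mirXmap innerRef 1 = (innerRef - genU) 1; unfold mirXmap; rw [PiLp.sub_apply, h1, i0, i1, u1]; ring
    · change mirXmap innerRef 2 = (innerRef - genU) 2; unfold mirXmap; rw [PiLp.sub_apply, h2, u2]; ring

/-- a linear map sending the three generators into `Λ₀` maps `Λ₀` into `Λ₀`. [folklore] -/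
theorem mapsTo_Λ₀_of_gens (f : E3 →ₗ[ℝ] E3) (hu : f genU ∈ Λ₀) (hv : f genV ∈ Λ₀) (hc : f genC ∈ Λ₀) :
    ∀ z ∈ Λ₀, f z ∈ Λ₀ := by
  rintro z ⟨i, j, k, rfl⟩
  have e : f ((i : ℝ) • triangularVec₁ 1 + (j : ℝ) • triangularVec₂ 1 + (k : ℝ) • layerNormal (2 * Real.sqrt (2 / 3))) =
      (i : ℝ) • f genU + (j : ℝ) • f genV + (k : ℝ) • f genC := by
    rw [map_add, map_add, map_smul, map_smul, map_smul]; rfl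
  rw [e]
  -- integer multiples of lattice vectors are lattice vectors
  have hz : ∀ (n : ℤ) {x : E3}, x ∈ Λ₀ → (n : ℝ) • x ∈ Λ₀ := by
    intro n x hx
    obtain ⟨a, b, c, rfl⟩ := hx
    refine ⟨n * a, n * b, n * c, ?_⟩
    push_cast
    simp only [smul_add, smul_smul]
  exact Λ₀_add_mem (Λ₀_add_mem (hz i hu) (hz j hv)) (hz k hc)

/-- the generators lie in `Λ₀`. [folklore] -/
theorem gens_mem_Λ₀ : genU ∈ Λ₀ ∧ genV ∈ Λ₀ ∧ genC ∈ Λ₀ :=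
  ⟨⟨1, 0, 0, by simp [genU]⟩, ⟨0, 1, 0, by simp [genV]⟩, ⟨0, 0, 1, by simp [genC]⟩⟩

/-- **the mirror `u ↔ v` as a lattice isometry.** -/
def mirUV : LatticeIsometry where
  S := mirUVli
  mapsTo := by
    obtain ⟨hu, hv, hc, -⟩ := mirUV_gens
    obtain ⟨gu, gv, gc⟩ := gens_mem_Λ₀
    intro z hz
    rw [mirUVli_apply]
    exact mapsTo_Λ₀_of_gens mirUVmap (by rw [hu]; exact gv) (by rw [hv]; exact gu) (by rw [hc]; exact gc) z hz
  mapsTo_symm := by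
    obtain ⟨hu, hv, hc, -⟩ := mirUV_gens
    obtain ⟨gu, gv, gc⟩ := gens_mem_Λ₀
    intro z hz
    rw [mirUVli_symm_apply]
    exact mapsTo_Λ₀_of_gens mirUVmap (by rw [hu]; exact gv) (by rw [hv]; exact gu) (by rw [hc]; exact gc) z hz
  shift_mem := by
    obtain ⟨-, -, -, hi⟩ := mirUV_gens
    rw [mirUVli_apply, hi, sub_self]; exact zero_mem_Λ₀

/-- **the mirror `x ↦ −x` as a lattice isometry.** -/
def mirX : LatticeIsometry where
  S := mirXli
  mapsTo := by
    obtain ⟨hu, hv, hc, -⟩ := mirX_gens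
    obtain ⟨gu, gv, gc⟩ := gens_mem_Λ₀
    intro z hz
    rw [mirXli_apply]
    exact mapsTo_Λ₀_of_gens mirXmap (by rw [hu]; exact Λ₀_neg_mem gu) (by rw [hv]; exact Λ₀_sub_mem gv gu)
      (by rw [hc]; exact gc) z hz
  mapsTo_symm := by
    obtain ⟨hu, hv, hc, -⟩ := mirX_gens
    obtain ⟨gu, gv, gc⟩ := gens_mem_Λ₀
    intro z hz
    rw [mirXli_symm_apply]
    exact mapsTo_Λ₀_of_gens mirXmap (by rw [hu]; exact Λ₀_neg_mem gu) (by rw [hv]; exact Λ₀_sub_mem gv gu)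
      (by rw [hc]; exact gc) z hz
  shift_mem := by
    obtain ⟨-, -, -, hi⟩ := mirX_gens
    rw [mirXli_apply, hi, show innerRef - genU - innerRef = -genU by abel]
    exact Λ₀_neg_mem gens_mem_Λ₀.1

/-! ## Composition of lattice isometries -/

/-- composition of lattice isometries (`g` first, then `g'`). -/
def LatticeIsometry.comp (g g' : LatticeIsometry) : LatticeIsometry where
  S := g.S.trans g'.S
  mapsTo := fun z hz => g'.mapsTo _ (g.mapsTo z hz)
  mapsTo_symm := fun z hz => by
    rw [LinearIsometryEquiv.symm_trans, LinearIsometryEquiv.trans_apply]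
    exact g.mapsTo_symm _ (g'.mapsTo_symm z hz)
  shift_mem := by
    rw [LinearIsometryEquiv.trans_apply]
    have e : g'.S (g.S innerRef) - innerRef = g'.S (g.S innerRef - innerRef) + (g'.S innerRef - innerRef) := by
      rw [map_sub]; abel
    rw [e]
    exact Λ₀_add_mem (g'.mapsTo _ g.shift_mem) g'.shift_mem

/-- the composed isometry applied. [folklore] -/
theorem LatticeIsometry.comp_S_apply (g g' : LatticeIsometry) (x : E3) : (g.comp g').S x = g'.S (g.S x) := rfl

/-! ## The in-plane fundamental domain -/

/-- the identity as a lattice isometry. -/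
def LatticeIsometry.one : LatticeIsometry where
  S := LinearIsometryEquiv.refl ℝ E3
  mapsTo := fun z hz => hz
  mapsTo_symm := fun z hz => hz
  shift_mem := by simp [zero_mem_Λ₀]

/-- the three in-plane nearest-neighbour stretches are ORDERED: `‖Au‖ ≤ ‖Av‖ ≤ ‖A(u − v)‖` (a predicate on data, the fundamental domain of the basal mirrors; not a named fact). [folklore] -/
def inPlaneOrdered (_t : Fin 2 → E3) (A : E3 →L[ℝ] E3) : Prop :=
  ‖A genU‖ ≤ ‖A genV‖ ∧ ‖A genV‖ ≤ ‖A (genU - genV)‖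

section Cover

variable (t : Fin 2 → E3) (A : E3 →L[ℝ] E3)

/-- images of `u, v, u − v` under the six words. [folklore] -/
theorem word_images :
    (mirUV.S genU = genV ∧ mirUV.S genV = genU ∧ mirUV.S (genU - genV) = -(genU - genV)) ∧
    (mirX.S genU = -genU ∧ mirX.S genV = -(genU - genV) ∧ mirX.S (genU - genV) = -genV) ∧
    ((mirUV.comp mirX).S genU = -(genU - genV) ∧ (mirUV.comp mirX).S genV = -genU ∧
      (mirUV.comp mirX).S (genU - genV) = genV) ∧
    ((mirX.comp mirUV).S genU = -genV ∧ (mirX.comp mirUV).S genV = genU - genV ∧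
      (mirX.comp mirUV).S (genU - genV) = -genU) ∧
    (((mirUV.comp mirX).comp mirUV).S genU = genU - genV ∧ ((mirUV.comp mirX).comp mirUV).S genV = -genV ∧
      ((mirUV.comp mirX).comp mirUV).S (genU - genV) = genU) := by
  obtain ⟨hu, hv, -, -⟩ := mirUV_gens
  obtain ⟨gu, gv, -, -⟩ := mirX_gens
  have s1 : ∀ x, mirUV.S x = mirUVmap x := fun _ => rfl
  have s2 : ∀ x, mirX.S x = mirXmap x := fun _ => rfl
  have huv : mirUVmap (genU - genV) = -(genU - genV) := by rw [map_sub, hu, hv]; abel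
  have guv : mirXmap (genU - genV) = -genV := by rw [map_sub, gu, gv]; abel
  have hnu : mirUVmap (-genU) = -genV := by rw [map_neg, hu]
  have hnv : mirUVmap (-genV) = -genU := by rw [map_neg, hv]
  have hnuv : mirUVmap (-(genU - genV)) = genU - genV := by rw [map_neg, huv, neg_neg]
  have gnu : mirXmap (-genU) = genU := by rw [map_neg, gu, neg_neg]
  have gnuv : mirXmap (-(genU - genV)) = genV := by rw [map_neg, guv, neg_neg]
  have hvu : mirUVmap (genV - genU) = genU - genV := by rw [map_sub, hu, hv]
  have gv' : mirXmap genV = -(genU - genV) := by rw [gv]; abel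
  refine ⟨⟨hu, hv, huv⟩, ⟨gu, gv', guv⟩, ⟨?_, ?_, ?_⟩, ⟨?_, ?_, ?_⟩, ⟨?_, ?_, ?_⟩⟩
  · rw [LatticeIsometry.comp_S_apply, s1, s2, hu, gv']
  · rw [LatticeIsometry.comp_S_apply, s1, s2, hv, gu]
  · rw [LatticeIsometry.comp_S_apply, s1, s2, huv, gnuv]
  · rw [LatticeIsometry.comp_S_apply, s2, s1, gu, hnu]
  · rw [LatticeIsometry.comp_S_apply, s2, s1, gv, hvu]
  · rw [LatticeIsometry.comp_S_apply, s2, s1, guv, hnv]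
  · rw [LatticeIsometry.comp_S_apply, LatticeIsometry.comp_S_apply, s1, s2, s1, hu, gv, hvu]
  · rw [LatticeIsometry.comp_S_apply, LatticeIsometry.comp_S_apply, s1, s2, s1, hv, gu, hnu]
  · rw [LatticeIsometry.comp_S_apply, LatticeIsometry.comp_S_apply, s1, s2, s1, huv, gnuv, hv]

/-- **EVERY DATUM IS RE-DESCRIBED INTO THE IN-PLANE FUNDAMENTAL DOMAIN.** -/
theorem cover_inPlaneOrdered :
    ∃ g : LatticeIsometry, inPlaneOrdered (g.actT t A) (g.actA A) := by
  obtain ⟨⟨a1, a2, a3⟩, ⟨b1, b2, b3⟩, ⟨c1, c2, c3⟩, ⟨d1, d2, d3⟩, ⟨e1, e2, e3⟩⟩ := word_images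
  unfold inPlaneOrdered
  rcases le_total ‖A genU‖ ‖A genV‖ with hab | hba
  · rcases le_total ‖A genV‖ ‖A (genU - genV)‖ with hbc | hcb
    · exact ⟨LatticeIsometry.one, by simpa [LatticeIsometry.one] using hab, by simpa [LatticeIsometry.one] using hbc⟩
    · rcases le_total ‖A genU‖ ‖A (genU - genV)‖ with hac | hca
      · refine ⟨mirX, ?_, ?_⟩ <;> simp only [LatticeIsometry.actA_apply, b1, b2, b3, map_neg, norm_neg]
        · exact hac
        · exact hcb
      · refine ⟨mirUV.comp mirX, ?_, ?_⟩ <;> simp only [LatticeIsometry.actA_apply, c1, c2, c3, map_neg, norm_neg]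
        · exact hca
        · exact hab
  · rcases le_total ‖A genU‖ ‖A (genU - genV)‖ with hac | hca
    · refine ⟨mirUV, ?_, ?_⟩ <;> simp only [LatticeIsometry.actA_apply, a1, a2, a3, map_neg, norm_neg]
      · exact hba
      · exact hac
    · rcases le_total ‖A genV‖ ‖A (genU - genV)‖ with hbc | hcb
      · refine ⟨mirX.comp mirUV, ?_, ?_⟩ <;> simp only [LatticeIsometry.actA_apply, d1, d2, d3, map_neg, norm_neg]
        · exact hbc
        · exact hca
      · refine ⟨(mirUV.comp mirX).comp mirUV, ?_, ?_⟩ <;>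
          simp only [LatticeIsometry.actA_apply, e1, e2, e3, map_neg, norm_neg]
        · exact hcb
        · exact hba

end Cover

/-- **STABILITY FROM THE IN-PLANE FUNDAMENTAL DOMAIN** (one sixth of the strain window). -/
theorem phononStabilityOn_of_inPlaneOrdered
    (h : PhononStabilityOn fun t A => Adm₀ A ∧ Inner₀ t A ∧ inPlaneOrdered t A) :
    PhononStabilityOn fun t A => Adm₀ A ∧ Inner₀ t A :=
  phononStabilityOn_of_redescription (fun t A _ _ => cover_inPlaneOrdered t A) h

/-- Anchor of this support file (registered stub of the line skeleton, lead c2): every datum has an ordered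
re-description. -/
theorem stub_certSymmHcp : ∀ (t : Fin 2 → EuclideanSpace ℝ (Fin 3)) (A : EuclideanSpace ℝ (Fin 3) →L[ℝ] EuclideanSpace ℝ (Fin 3)), ∃ g : LatticeIsometry, inPlaneOrdered (g.actT t A) (g.actA A) :=
  fun t A => cover_inPlaneOrdered t A

end Summit.AtomisticToContinuum.Crystallization.Theorems.PhononStabilityCWC

end
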